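import Literature.NumberTheory.GaloisRepresentations.CyclotomicCharacterArtinNormProofs
import HarnessLib

/-!
# The Lubin–Tate character does not depend on the series: `Γ_F` acts on the division points of `F_g`
# through `χ_π` for EVERY `g ∈ 𝔉_π`

Step "P4½" of the Lubin–Tate programme (`LubinTate.lean`, `LubinTatePoints.lean`, `LubinTateTorsion.lean`,
`LubinTateCharacter.lean`, `LubinTateCharacterLimit.lean`). There the character `χ_π = lubinTateChar hπ : Γ_F → 𝒪_Fˣ`
is constructed from the division points of the PARTICULAR Lubin–Tate series `f = πX + X^q` (`ltPoly F π`):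
`σ • [b]_f λ_{n+1} = [χ_π(σ) b]_f λ_{n+1}` (`absGal_smul_ltAct_lubinTateChar`). Cassels–Fröhlich VI §3.4–3.6 and
Lubin–Tate 1965 §1 work with an ARBITRARY `g ∈ 𝔉_π` (`g ≡ πX mod deg 2`, `g ≡ X^q mod π`): the formal groups `F_f`,
`F_g` are canonically isomorphic over `𝒪_F` by `[1]_{f,g}` (Lubin–Tate 1965 Thm. 1 / Cassels–Fröhlich VI §3.5
Prop. 2–3, tree `LubinTate.hom`), so the division-point modules, the fields they generate and the Galois character are
the same for all `g`. This file proves the Galois half of that independence, **fully**: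

* §1 (any complete Hausdorff linearly topologised `A`-algebra `S`, any closed nil ideal `M`, any `f, g, h ∈ 𝔉_π` over an
  LT ring `A`): `LubinTate.evalPt₁_hom_evalPt₁_hom` (`[a]_{f,g}([b]_{g,h} x) = [ab]_{f,h} x`, Lubin–Tate's (9) on points,
  three series) and `LubinTate.evalPt₁_zero` (`h(0) = 0`). The two-series transport lemmas (`ltSMul_evalPt₁_hom_one`,
  `evalPt₁_hom_one_evalPt₁_hom_one`) and «`σ` commutes with evaluation» (`mapPt_evalPt₁`) are the tree's
  (`CyclotomicCharacterArtinNormProofs`, where the case `g = (X+1)^ℓ − 1` — the cyclotomic character — is treated).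
* §2 ★ `absGal_smul_eq_ltSMul_lubinTateChar` — **for every `g ∈ 𝔉_π` and every `π^{n+1}`-division point `x` of
  `F_g` in `𝔪_{K_π^{n+1}}`: `σ • x = [χ_π(σ)]_g x` for all `σ ∈ Γ_F`.** Proof: `y := [1]_{f,g} x` is a
  `π^{n+1}`-division point of `F_f` in `K_π^{n+1}`, hence `y = [b]_f λ_{n+1}` (`card_roots_ltPolyIter`); `Γ_F` acts on
  `y` by `[χ_π(σ)]_f` (`absGal_smul_ltAct_lubinTateChar`); transport back along `[1]_{g,f}`, which commutes with `σ`
  (coefficients in `𝒪_F`) and intertwines `[c]_f` with `[c]_g`.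

Consumers: the supersingular sector of «`V_pE` is de Rham» for an elliptic curve with `a_p = 0` (BSD crux K★
stmt-BirchSwinnertonDyer-22226, memo `Cruxes/StarredOptimalManinUnitFiveSeven/Lines/kato-lever-hDR-programme.md` §3 (f′2c)):
the formal group of such a curve over `ℤ_{p²}` is `F_g` for `g = i([p]X) ∈ 𝔉_{−p}` (tree, route RTT,
`RelativeLubinTate.formalGroupLaw_eq_ltF`), not for the standard `f`.

What is NOT here: that the `π^{n+1}`-division points of `F_g` in an arbitrary finite `E ⊆ F̄` already lie in
`K_π^{n+1}` (the field half of the independence); local class field theory.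

## References
* J. Lubin, J. Tate, *Formal complex multiplication in local fields*, Ann. of Math. 81 (1965), §1 Thm. 1 (identities
  (8)–(11)), §2 Thm. 2 and Cor. (independence of `g`). [LubinTate1965]
* J.-P. Serre, *Local class field theory*, Ch. VI of Cassels–Fröhlich (1967), §3.4 Thm. 3, §3.5 Props. 2–3, §3.6
  Prop. 6. [CasselsFrohlichANT1967]

## Mathlib reuse
`MvPowerSeries.aeval`, `MvPowerSeries.comp_aeval`, `MvPowerSeries.aeval_eq_sum`, `AlgEquiv.restrictNormalHom`,
`AlgEquiv.restrictNormal_commutes`, `Polynomial.mem_roots`; from the tree: everything of the five Lubin–Tate files listed above.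
-/

noncomputable section

open Filter Topology Polynomial

namespace Literature.NumberTheory.GaloisRepresentations

/-! ### §1 Transport of point operations along the Lubin–Tate homomorphisms `[a]_{f,g}` -/

namespace LubinTate

section Transport

variable {A : Type*} [CommRing A] [UniformSpace A] [DiscreteUniformity A]
variable {S : Type*} [CommRing S] [UniformSpace S] [IsUniformAddGroup S] [IsTopologicalRing S]
  [IsLinearTopology S S] [T2Space S] [CompleteSpace S] [Algebra A S] [ContinuousSMul A S]
variable (M : NilIdeal S) {π : A} {q : ℕ} (hA : IsLTRing π q) {f g h : PowerSeries A}
  (hf : IsLTSeries π q f) (hg : IsLTSeries π q g) (hh : IsLTSeries π q h)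

/-- **`h(0) = 0` on points** for any constant-term-free series `h` (generalises the tree's `ltSMul_zero`; the
convergent evaluation of Cassels–Fröhlich VI §3.2 at the origin). [cite: CasselsFrohlichANT1967, Ch. VI §3.2] -/
theorem evalPt₁_zero (k : PowerSeries A) (hk : PowerSeries.constantCoeff k = 0) : evalPt₁ M k hk 0 = 0 := by
  classical
  apply Subtype.ext
  unfold evalPt₁
  rw [coe_evalPt, MvPowerSeries.aeval_eq_sum]
  change (∑' d : Unit →₀ ℕ, MvPowerSeries.coeff d k •
    d.prod (fun s e => ((0 : M.toIdeal) : S) ^ e)) = (0 : S)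
  refine (tsum_congr fun d => ?_).trans tsum_zero
  by_cases hd : d = 0
  · subst hd
    rw [MvPowerSeries.coeff_zero_eq_constantCoeff_apply]
    change PowerSeries.constantCoeff k • _ = (0 : S)
    rw [hk, zero_smul]
  · obtain ⟨i, hi⟩ := Finsupp.ne_iff.mp hd
    rw [Finsupp.prod, ← Finset.prod_erase_mul _ _ (Finsupp.mem_support_iff.mpr hi)]
    simp [zero_pow hi]

/-- **`[a]_{f,g}([b]_{g,h} x) = [ab]_{f,h} x` on points** (Lubin–Tate's identity (9), tree `hom_comp_hom`,
transported by `evalPt₁_subst`). [cite: LubinTate1965, §1 Thm. 1 (9)] -/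
theorem evalPt₁_hom_evalPt₁_hom (a b : A) (x : M.toIdeal) :
    evalPt₁ M (hom hA hf hg a) (constantCoeff_hom hA hf hg a)
        (evalPt₁ M (hom hA hg hh b) (constantCoeff_hom hA hg hh b) x) =
      evalPt₁ M (hom hA hf hh (a * b)) (constantCoeff_hom hA hf hh (a * b)) x := by
  have hc : MvPowerSeries.constantCoeff (PowerSeries.subst (hom hA hg hh b) (hom hA hf hg a)) = 0 := by
    rw [hom_comp_hom hA hf hg hh a b]; exact constantCoeff_hom' hA hf hh (a * b)
  have h1 := evalPt₁_subst M (τ := Unit) (hom hA hg hh b) (constantCoeff_hom' hA hg hh b)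
    (hom hA hf hg a) (constantCoeff_hom hA hf hg a) hc (fun _ => x)
  change _ = evalPt₁ M (hom hA hf hg a) _ (evalPt₁ M (hom hA hg hh b) _ x) at h1
  rw [← h1]
  exact evalPt_congr M (hom_comp_hom hA hf hg hh a b) hc _ (fun _ => x)

end Transport

end LubinTate

section Concrete

open ValuativeRel GaloisRepresentations.IsNonarchimedeanLocalField LubinTate

variable {F : Type*} [Field F] [ValuativeRel F] [TopologicalSpace F] [IsNonarchimedeanLocalField F]

section Normed

-- The normed-field instances on `F` and on the finite subextensions of `F̄` are those declared
-- (as local instances) in `LubinTateTorsion.lean`; they are re-activated here verbatim so that the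
-- instances and definitions built there and in `LubinTateCharacter(Limit).lean` apply.
attribute [local instance] instUniformSpace_literature rk1 nF nE ltCharIsUniformAddGroup

/-! ### §2 The Galois action on the division points of `F_g`, for every `g ∈ 𝔉_π` -/

variable {π : 𝒪[F]} (hπ : (valuation F).IsUniformizer (π : F))

/-- ★ **The Lubin–Tate character is independent of the series.** Let `g ∈ 𝔉_π` be ANY Lubin–Tate series over `𝒪_F`
(`g ≡ πX mod deg 2`, `g ≡ X^q mod π`) and `x ∈ 𝔪_{K_π^{n+1}}` a `π^{n+1}`-division point of `F_g`
(`[π^{n+1}]_g x = 0`). Then every `σ ∈ Γ_F` acts on `x` (inside `F̄`) by the Lubin–Tate character built from the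
standard series `f = πX + X^q`: **`σ • x = [χ_π(σ)]_g x`**. Proof: `y = [1]_{f,g} x` is a `π^{n+1}`-division point of
`F_f` (`[π^{n+1}]_f y = [1]_{f,g}([π^{n+1}]_g x) = 0`), hence a root of `f^{(n+1)}`, hence `y = [b]_f λ_{n+1}`
(`card_roots_ltPolyIter`) and `σ • y = [χ_π(σ)]_f y` (`absGal_smul_ltAct_lubinTateChar`); now `x = [1]_{g,f} y`,
`σ` commutes with `[1]_{g,f}` (`mapPt_evalPt₁`) and `[1]_{g,f}[c]_f = [c]_g[1]_{g,f}` (`ltSMul_evalPt₁_hom_one`).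
[cite: LubinTate1965, §2 Thm. 2 and Cor.] [cite: CasselsFrohlichANT1967, Ch. VI §3.4 Thm. 3 (b) and §3.6 Prop. 6 (b)] -/
theorem absGal_smul_eq_ltSMul_lubinTateChar (n : ℕ) {g : PowerSeries (LTCoeff F)}
    (hg : IsLTSeries (LTCoeff.of F π) (residueFieldCard F) g)
    (x : (maxNilIdeal F (ltField π n)).toIdeal)
    (hx : ltSMul (maxNilIdeal F (ltField π n)) (isLTRing_LTCoeff hπ) hg ((LTCoeff.of F π) ^ (n + 1)) x = 0)
    (σ : Field.absoluteGaloisGroup F) :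
    σ • (((x : unitBall (ltField π n)) : ltField π n) : AlgebraicClosure F) =
      (((ltSMul (maxNilIdeal F (ltField π n)) (isLTRing_LTCoeff hπ) hg
          (LTCoeff.of F (lubinTateChar hπ σ : 𝒪[F])) x : unitBall (ltField π n)) : ltField π n) :
        AlgebraicClosure F) := by
  classical
  haveI := isGalois_ltField hπ n
  have hA := isLTRing_LTCoeff (F := F) hπ
  have hf := isLTSeries_LTCoeff (F := F) π
  -- `y := [1]_{f,g} x` is a `π^{n+1}`-division point of `F_f`
  set y : (maxNilIdeal F (ltField π n)).toIdeal :=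
    evalPt₁ (maxNilIdeal F (ltField π n)) (hom hA hf hg 1) (constantCoeff_hom hA hf hg 1) x with hy
  have hy0 : ltSMul (maxNilIdeal F (ltField π n)) hA hf ((LTCoeff.of F π) ^ (n + 1)) y = 0 := by
    rw [hy, ltSMul_evalPt₁_hom_one (maxNilIdeal F (ltField π n)) hA hg hf, hx, LubinTate.evalPt₁_zero]
  -- hence `y = [b]_f λ_{n+1}` for some `b`
  obtain ⟨-, -, hroots⟩ := card_roots_ltPolyIter hπ n
  have hP0 : (((ltPolyIter F π (n + 1)).map (algebraMap 𝒪[F] F)).map (algebraMap F (ltField π n))) ≠ 0 :=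
    (((monic_ltPolyIter π (n + 1)).1.map _).map _).ne_zero
  obtain ⟨b, hb⟩ := hroots ((y : unitBall (ltField π n)) : ltField π n) (by
    rw [Polynomial.mem_roots hP0, Polynomial.IsRoot.def, Polynomial.eval_map, ← Polynomial.aeval_def,
      ← coe_ltSMul_pow hπ (n + 1) y, hy0]
    rfl)
  have hyb : y = ltAct hπ n b (genPt hπ n) := Subtype.ext (Subtype.ext hb)
  -- `Γ_F` acts on `y` through `χ_π`
  have hσy : σ • (((y : unitBall (ltField π n)) : ltField π n) : AlgebraicClosure F) =
      (((ltAct hπ n (lubinTateChar hπ σ : 𝒪[F]) y : unitBall (ltField π n)) : ltField π n) :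
        AlgebraicClosure F) := by
    rw [hyb, absGal_smul_ltAct_lubinTateChar, ltAct_mul]
  -- the restriction of `σ` to the normal extension `K_π^{n+1}`
  set σ' : ltField π n ≃ₐ[F] ltField π n :=
    AlgEquiv.restrictNormalHom (ltField π n) (Field.absoluteGaloisGroup.toAlgEquiv F σ) with hσ'
  have hres : ∀ z : ltField π n,
      σ • (z : AlgebraicClosure F) = ((σ' z : ltField π n) : AlgebraicClosure F) := by
    intro z
    rw [Field.absoluteGaloisGroup.smul_def, hσ']
    exact (AlgEquiv.restrictNormal_commutes (Field.absoluteGaloisGroup.toAlgEquiv F σ) (ltField π n) z).symm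
  have hmap : mapPt σ' y = ltAct hπ n (lubinTateChar hπ σ : 𝒪[F]) y := by
    apply Subtype.ext; apply Subtype.ext; apply Subtype.ext
    change ((σ' ((y : unitBall (ltField π n)) : ltField π n) : ltField π n) : AlgebraicClosure F) = _
    rw [← hres, hσy]
  -- `x = [1]_{g,f} y`, and `[1]_{g,f}` commutes with `σ` and intertwines `[c]_f` with `[c]_g`
  have hxy : x = evalPt₁ (maxNilIdeal F (ltField π n)) (hom hA hg hf 1) (constantCoeff_hom hA hg hf 1) y :=
    (evalPt₁_hom_one_evalPt₁_hom_one (maxNilIdeal F (ltField π n)) hA hg hf x).symm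
  have hpt : mapPt σ' x = ltSMul (maxNilIdeal F (ltField π n)) hA hg
      (LTCoeff.of F (lubinTateChar hπ σ : 𝒪[F])) x := by
    rw [hxy, mapPt_evalPt₁, hmap]
    exact (ltSMul_evalPt₁_hom_one (maxNilIdeal F (ltField π n)) hA hf hg _ y).symm
  calc σ • (((x : unitBall (ltField π n)) : ltField π n) : AlgebraicClosure F)
      = ((σ' ((x : unitBall (ltField π n)) : ltField π n) : ltField π n) : AlgebraicClosure F) := hres _
    _ = ((((mapPt σ' x : (maxNilIdeal F (ltField π n)).toIdeal) : unitBall (ltField π n)) :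
          ltField π n) : AlgebraicClosure F) := by rw [coe_mapPt]
    _ = _ := by rw [hpt]

/-- **Corollary (the level-`n+1` Lubin–Tate character read off `F_g`).** With `x` as above and `u := χ_π(σ)`:
`σ • x = [u]_g x`, and `u` is the SAME unit for every `g ∈ 𝔉_π` and every division point — in particular for the
generator `λ_{n+1}` of the standard `F_f` (`absGal_smul_ltRoot`). Stated as the conjunction used by consumers.
[cite: LubinTate1965, §2 Thm. 2 Cor.] -/
theorem absGal_smul_eq_ltSMul_lubinTateChar_and_ltRoot (n : ℕ) {g : PowerSeries (LTCoeff F)}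
    (hg : IsLTSeries (LTCoeff.of F π) (residueFieldCard F) g)
    (x : (maxNilIdeal F (ltField π n)).toIdeal)
    (hx : ltSMul (maxNilIdeal F (ltField π n)) (isLTRing_LTCoeff hπ) hg ((LTCoeff.of F π) ^ (n + 1)) x = 0)
    (σ : Field.absoluteGaloisGroup F) :
    σ • (((x : unitBall (ltField π n)) : ltField π n) : AlgebraicClosure F) =
      (((ltSMul (maxNilIdeal F (ltField π n)) (isLTRing_LTCoeff hπ) hg
          (LTCoeff.of F (lubinTateChar hπ σ : 𝒪[F])) x : unitBall (ltField π n)) : ltField π n) :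
        AlgebraicClosure F) ∧
    σ • ltRoot π n =
      (((ltAct hπ n (lubinTateChar hπ σ : 𝒪[F]) (genPt hπ n) : unitBall (ltField π n)) :
        ltField π n) : AlgebraicClosure F) :=
  ⟨absGal_smul_eq_ltSMul_lubinTateChar hπ n hg x hx σ, absGal_smul_ltRoot hπ σ n⟩

end Normed

end Concrete

end Literature.NumberTheory.GaloisRepresentations

end
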